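import Literature.NumberTheory.Sieve.FriedlanderIwaniecPrimesJacobiTwistedProp111StarMixed
import HarnessLib

/-!
# Friedlander–Iwaniec, *The polynomial `X² + Y⁴` captures its primes*, §12: Proposition 11.1* summed
# over the dyadic blocks of the `q`-range (12.12)

[FI, §12, p. 51 of arXiv:math/9811185 = Ann. of Math. (2) 148 (1998), 945–1040]: "we observe that `q`
runs over the segment (12.12) `RS/(cDH) < q < 24RS/(cD)` … At last we are ready to apply
Proposition 11.1*.  This gives, by (12.12), (12.15) and (12.16),
`V_{cm}(f,g) ≪ {(cm)^{-1/2}(DHRS)^{1/2}(log 2RS)³ + [c^{-3/2} m D⁻¹(RS)^{3/2} + RS^{3/4} + SR^{3/4}](RS)^ε} ∑∑ |α_{crs}|²`."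

Proposition 11.1* (tree: `exists_prop111Star_mixed`, the printed mixed-norm form on the reduced boxes
`R/N < r ≤ 2R/N`) bounds the sum over ONE dyadic block `Q < q ≤ 2Q` of moduli.  This file PROVES the
summation over all blocks meeting a range `Q₁ < q ≤ Q₂` (`exists_prop111Star_mixed_range`): each
block `2^j < q ≤ 2^{j+1}` meeting the range has `2^{j+1} > Q₁` and `2^j ≤ Q₂`, so its bound is at most
`C[√2·XS/√(mQ₁)·log 2R·‖α‖‖β‖ + (mQ₂√(XS) + XS^{3/4} + SX^{3/4})(XS)^ε (∑τ|α|²)^{1/2}(∑τ|β|²)^{1/2}]`,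
`X = R/N`; there are at most `log₂ Q₂ + 1 ≤ 2(1 + log Q₂)` blocks; and the modulus `q = 1` (not covered
by any block `Q < q ≤ 2Q`, `Q ≥ 1`) is bounded trivially by `#box · ‖α‖‖β‖ ≤ 2XS‖α‖‖β‖`.
With `X = R/c`, `Q₁ = 2RS/(5cDH)`, `Q₂ = 24RS/(cD)` this is FI's display above (the `log`-power
bookkeeping is left to the assembly).  No definitions, no named facts
(HOME/parity-ideate-lit/FI98-Prop121-MAP.md, step D2 of the g26 addendum).

## References

* J. Friedlander, H. Iwaniec, *The polynomial `X² + Y⁴` captures its primes*, Ann. of Math. (2) 148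
  (1998), 945–1040, §12, (12.12), (12.15)–(12.17). [FriedlanderIwaniecAnnals1998]
-/

noncomputable section

open Finset Real Complex
open scoped NumberTheorySymbols ArithmeticFunction.sigma Nat ComplexConjugate

namespace Literature.NumberTheory.Sieve.FriedlanderIwaniecPrimes

/-- `Nat.log 2 n ≤ 2(1 + log Q) - 1` for `n ≤ Q`, `Q ≥ 1`; i.e. the number of dyadic blocks below `Q`
is at most `2(1 + log Q)`. [folklore] -/
private theorem natLog_two_succ_le_two_mul {n : ℕ} {Q : ℝ} (hQ : 1 ≤ Q) (hn : (n : ℝ) ≤ Q) :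
    ((Nat.log 2 n + 1 : ℕ) : ℝ) ≤ 2 * (1 + Real.log Q) := by
  have hlogQ : 0 ≤ Real.log Q := Real.log_nonneg hQ
  rcases Nat.eq_zero_or_pos n with hn0 | hnpos
  · subst hn0
    simp
    linarith
  · have h1 : (2 : ℝ) ^ (Nat.log 2 n) ≤ n := by
      exact_mod_cast Nat.pow_log_le_self 2 hnpos.ne'
    have h2 : (Nat.log 2 n : ℝ) * Real.log 2 ≤ Real.log Q := by
      rw [← Real.log_pow]
      exact Real.log_le_log (by positivity) (h1.trans hn)
    have hlog2 : (0.6931471803 : ℝ) < Real.log 2 := Real.log_two_gt_d9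
    have h3 : (Nat.log 2 n : ℝ) ≤ Real.log Q / Real.log 2 := by
      rw [le_div_iff₀ (by linarith)]; exact h2
    have h4 : Real.log Q / Real.log 2 ≤ 2 * Real.log Q := by
      rw [div_le_iff₀ (by linarith)]
      nlinarith
    push_cast
    linarith

/-- `|(a/b)| ≤ 1`. [folklore] -/
private theorem norm_jacobiSym_le_one'' (a : ℤ) (b : ℕ) : ‖(J(a | b) : ℂ)‖ ≤ 1 := by
  rcases jacobiSym.trichotomy a b with h | h | h <;> simp [h]

/-- **Proposition 11.1* over a range of moduli** [FI, §12, (12.12) and after (12.16)]: for every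
`0 < ε ≤ 1` there is `C > 0` such that for `m, S ≥ 1`, `1 ≤ N ≤ R`, reals `Q₁ > 0`, `Q₂ ≥ 1`, a finite
set `𝒬` of moduli `q ≥ 1` with `Q₁ < q ≤ Q₂`, and vectors `α, β` on the reduced box
`R/N < r ≤ 2R/N`, `S < s ≤ 2S` supported on odd `r` coprime to `m`,
`∑_{q ∈ 𝒬} |∑∑_{qm ∣ r₁s₂−r₂s₁, (r₁,r₂)=1} α_{r₁s₁} β̄_{r₂s₂} (q/(r₁r₂))|
   ≤ C (1 + log Q₂) { (XS/√(mQ₁) · log 2R + XS) ‖α‖‖β‖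
       + (mQ₂√(XS) + XS^{3/4} + SX^{3/4}) (XS)^ε (∑τ(r)|α_{rs}|²)^{1/2} (∑τ(r)|β_{rs}|²)^{1/2} }`, `X = R/N`
(dyadic blocks `2^j < q ≤ 2^{j+1}` via `exists_prop111Star_mixed`; the block-free modulus `q = 1`
trivially). [cite: FriedlanderIwaniecAnnals1998, §12, (12.12), (12.15)–(12.16)] -/
theorem exists_prop111Star_mixed_range {ε : ℝ} (hε : 0 < ε) (hε1 : ε ≤ 1) :
    ∃ C : ℝ, 0 < C ∧ ∀ (m R S N : ℕ) (𝒬 : Finset ℕ) (Q₁ Q₂ : ℝ) (α β : ℕ → ℕ → ℂ),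
      1 ≤ m → 1 ≤ S → 1 ≤ N → N ≤ R → 0 < Q₁ → 1 ≤ Q₂ →
      (∀ q ∈ 𝒬, 1 ≤ q ∧ Q₁ < (q : ℝ) ∧ (q : ℝ) ≤ Q₂) →
      (∀ r s, α r s ≠ 0 → Odd r ∧ r.Coprime m) → (∀ r s, β r s ≠ 0 → Odd r ∧ r.Coprime m) →
      ∑ q ∈ 𝒬, ‖∑ r₁ ∈ Ioc (R / N) (2 * R / N), ∑ s₁ ∈ Ioc S (2 * S),
          ∑ r₂ ∈ Ioc (R / N) (2 * R / N), ∑ s₂ ∈ Ioc S (2 * S),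
          (if ((q * m : ℕ) : ℤ) ∣ (r₁ : ℤ) * s₂ - (r₂ : ℤ) * s₁ ∧ r₁.Coprime r₂ then
            α r₁ s₁ * conj (β r₂ s₂) * (J((q : ℤ) | r₁ * r₂) : ℂ) else 0)‖ ≤
        C * (1 + Real.log Q₂) *
          (((R : ℝ) / N * S / Real.sqrt ((m : ℝ) * Q₁) * Real.log (2 * R) + (R : ℝ) / N * S) *
              (Real.sqrt (∑ r ∈ Ioc (R / N) (2 * R / N), ∑ s ∈ Ioc S (2 * S), ‖α r s‖ ^ 2) *
                Real.sqrt (∑ r ∈ Ioc (R / N) (2 * R / N), ∑ s ∈ Ioc S (2 * S), ‖β r s‖ ^ 2)) +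
            ((m : ℝ) * Q₂ * Real.sqrt ((R : ℝ) / N * S) + (R : ℝ) / N * (S : ℝ) ^ (3 / 4 : ℝ) +
                (S : ℝ) * ((R : ℝ) / N) ^ (3 / 4 : ℝ)) * ((R : ℝ) / N * S) ^ ε *
              (Real.sqrt (∑ r ∈ Ioc (R / N) (2 * R / N), ∑ s ∈ Ioc S (2 * S),
                  (σ 0 r : ℝ) * ‖α r s‖ ^ 2) *
                Real.sqrt (∑ r ∈ Ioc (R / N) (2 * R / N), ∑ s ∈ Ioc S (2 * S),
                  (σ 0 r : ℝ) * ‖β r s‖ ^ 2))) := by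
  obtain ⟨C, hC, h111⟩ := exists_prop111Star_mixed hε hε1
  refine ⟨4 * C + 2, by positivity, fun m R S N 𝒬 Q₁ Q₂ α β hm hS hN hNR hQ₁ hQ₂ h𝒬 hα hβ => ?_⟩
  set IT := Ioc (R / N) (2 * R / N) with hIT
  set IS := Ioc S (2 * S) with hIS
  set X : ℝ := (R : ℝ) / N with hX
  set Na : ℝ := Real.sqrt (∑ r ∈ IT, ∑ s ∈ IS, ‖α r s‖ ^ 2) with hNa
  set Nb : ℝ := Real.sqrt (∑ r ∈ IT, ∑ s ∈ IS, ‖β r s‖ ^ 2) with hNb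
  set Ta : ℝ := Real.sqrt (∑ r ∈ IT, ∑ s ∈ IS, (σ 0 r : ℝ) * ‖α r s‖ ^ 2) with hTa
  set Tb : ℝ := Real.sqrt (∑ r ∈ IT, ∑ s ∈ IS, (σ 0 r : ℝ) * ‖β r s‖ ^ 2) with hTb
  set f : ℕ → ℝ := fun q => ‖∑ r₁ ∈ IT, ∑ s₁ ∈ IS, ∑ r₂ ∈ IT, ∑ s₂ ∈ IS,
      (if ((q * m : ℕ) : ℤ) ∣ (r₁ : ℤ) * s₂ - (r₂ : ℤ) * s₁ ∧ r₁.Coprime r₂ then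
        α r₁ s₁ * conj (β r₂ s₂) * (J((q : ℤ) | r₁ * r₂) : ℂ) else 0)‖ with hf
  have hf0 : ∀ q, 0 ≤ f q := fun q => norm_nonneg _
  -- basic positivity
  have hR1 : (1 : ℝ) ≤ R := by exact_mod_cast hN.trans hNR
  have hX1 : 1 ≤ X := by
    rw [hX, le_div_iff₀ (by exact_mod_cast hN)]; simpa using (show (N : ℝ) ≤ R by exact_mod_cast hNR)
  have hX0 : 0 ≤ X := zero_le_one.trans hX1
  have hS0 : (0 : ℝ) ≤ S := Nat.cast_nonneg S
  have hm0 : (0 : ℝ) < m := by exact_mod_cast hm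
  have hlogR : 0 ≤ Real.log (2 * R) := Real.log_nonneg (by linarith)
  have hlogQ : 0 ≤ Real.log Q₂ := Real.log_nonneg hQ₂
  have hNa0 : 0 ≤ Na := Real.sqrt_nonneg _
  have hNb0 : 0 ≤ Nb := Real.sqrt_nonneg _
  have hTa0 : 0 ≤ Ta := Real.sqrt_nonneg _
  have hTb0 : 0 ≤ Tb := Real.sqrt_nonneg _
  have hXS0 : 0 ≤ X * S := mul_nonneg hX0 hS0
  have hXSe : 0 ≤ (X * S) ^ ε := Real.rpow_nonneg hXS0 ε
  have hNN : 0 ≤ Na * Nb := mul_nonneg hNa0 hNb0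
  have hTT : 0 ≤ Ta * Tb := mul_nonneg hTa0 hTb0
  have hP3 : 0 ≤ X * (S : ℝ) ^ (3 / 4 : ℝ) + (S : ℝ) * X ^ (3 / 4 : ℝ) :=
    add_nonneg (mul_nonneg hX0 (Real.rpow_nonneg hS0 _)) (mul_nonneg hS0 (Real.rpow_nonneg hX0 _))
  -- the uniform bound for one block meeting the range
  set Bmax : ℝ := C * (X * S * (Real.sqrt 2 / Real.sqrt ((m : ℝ) * Q₁)) * Real.log (2 * R) *
      (Na * Nb) + ((m : ℝ) * Q₂ * Real.sqrt (X * S) + X * (S : ℝ) ^ (3 / 4 : ℝ) +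
        (S : ℝ) * X ^ (3 / 4 : ℝ)) * (X * S) ^ ε * (Ta * Tb)) with hBmax
  have hBmax0 : 0 ≤ Bmax := by
    rw [hBmax]
    refine mul_nonneg hC.le (add_nonneg ?_ ?_)
    · exact mul_nonneg (mul_nonneg (mul_nonneg hXS0 (div_nonneg (Real.sqrt_nonneg _)
        (Real.sqrt_nonneg _))) hlogR) hNN
    · exact mul_nonneg (mul_nonneg (add_nonneg (add_nonneg (mul_nonneg (mul_nonneg hm0.le
        (by linarith)) (Real.sqrt_nonneg _)) (mul_nonneg hX0 (Real.rpow_nonneg hS0 _)))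
        (mul_nonneg hS0 (Real.rpow_nonneg hX0 _))) hXSe) hTT
  have hblock : ∀ j : ℕ, (∃ q ∈ 𝒬, 2 ^ j < q ∧ q ≤ 2 * 2 ^ j) →
      ∑ q ∈ Ioc (2 ^ j) (2 * 2 ^ j), f q ≤ Bmax := by
    intro j ⟨q₀, hq₀, hq₀l, hq₀u⟩
    obtain ⟨_, hQ₁q, hqQ₂⟩ := h𝒬 q₀ hq₀
    have hD : 1 ≤ 2 ^ j := Nat.one_le_two_pow
    have h : ∑ q ∈ Ioc (2 ^ j) (2 * 2 ^ j), f q ≤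
        C * (X * S / Real.sqrt ((m : ℝ) * (2 ^ j : ℕ)) * Real.log (2 * R) * (Na * Nb) +
          ((m : ℝ) * (2 ^ j : ℕ) * Real.sqrt (X * S) + X * (S : ℝ) ^ (3 / 4 : ℝ) +
            (S : ℝ) * X ^ (3 / 4 : ℝ)) * (X * S) ^ ε * (Ta * Tb)) :=
      h111 m (2 ^ j) R S N α β hm hD hS hN hNR hα hβ
    have hDr : (0 : ℝ) < (2 : ℝ) ^ j := by positivity
    have hDQ₁ : Q₁ / 2 ≤ (2 : ℝ) ^ j := by
      have : (q₀ : ℝ) ≤ 2 * (2 : ℝ) ^ j := by exact_mod_cast hq₀u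
      linarith
    have hDQ₂ : (2 : ℝ) ^ j ≤ Q₂ := by
      have : ((2 ^ j : ℕ) : ℝ) < q₀ := by exact_mod_cast hq₀l
      push_cast at this
      linarith
    -- compare the two `D`-dependent factors
    have hinv : 1 / Real.sqrt ((m : ℝ) * (2 ^ j : ℕ)) ≤ Real.sqrt 2 / Real.sqrt ((m : ℝ) * Q₁) := by
      push_cast
      rw [div_le_div_iff₀ (by positivity) (by positivity), one_mul, ← Real.sqrt_mul (by norm_num)]
      refine Real.sqrt_le_sqrt ?_
      nlinarith
    have hlin : (m : ℝ) * (2 ^ j : ℕ) * Real.sqrt (X * S) ≤ (m : ℝ) * Q₂ * Real.sqrt (X * S) := by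
      push_cast
      gcongr
    refine h.trans ?_
    rw [hBmax]
    have e1 : X * S / Real.sqrt ((m : ℝ) * (2 ^ j : ℕ)) =
        X * S * (1 / Real.sqrt ((m : ℝ) * (2 ^ j : ℕ))) := by ring
    rw [e1]
    refine mul_le_mul_of_nonneg_left (add_le_add ?_ ?_) hC.le
    · exact mul_le_mul_of_nonneg_right (mul_le_mul_of_nonneg_right
        (mul_le_mul_of_nonneg_left hinv hXS0) hlogR) hNN
    · refine mul_le_mul_of_nonneg_right (mul_le_mul_of_nonneg_right ?_ hXSe) hTT
      linarith [hlin]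
  -- the modulus `q = 1`
  have hone : f 1 ≤ 2 * (X * S) * (Na * Nb) := by
    have hcard : (#IT : ℝ) ≤ 2 * X := by
      rw [hIT, Nat.card_Ioc]
      have h1 : ((2 * R / N - R / N : ℕ) : ℝ) ≤ ((2 * R / N : ℕ) : ℝ) := by
        exact_mod_cast Nat.sub_le _ _
      refine h1.trans ?_
      calc ((2 * R / N : ℕ) : ℝ) ≤ (2 * R : ℕ) / (N : ℝ) := Nat.cast_div_le
        _ = 2 * X := by rw [hX]; push_cast; ring
    have hcardS : (#IS : ℝ) = S := by
      rw [hIS, Nat.card_Ioc, show 2 * S - S = S by omega]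
    -- `∑∑ |γ| ≤ √(#box) ‖γ‖`
    have hCS : ∀ γ : ℕ → ℕ → ℂ, ∑ r ∈ IT, ∑ s ∈ IS, ‖γ r s‖ ≤
        Real.sqrt ((#IT : ℝ) * #IS) * Real.sqrt (∑ r ∈ IT, ∑ s ∈ IS, ‖γ r s‖ ^ 2) := by
      intro γ
      have h1 : (∑ p ∈ IT ×ˢ IS, ‖γ p.1 p.2‖) ^ 2 ≤ #(IT ×ˢ IS) * ∑ p ∈ IT ×ˢ IS, ‖γ p.1 p.2‖ ^ 2 :=
        sq_sum_le_card_mul_sum_sq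
      have e1 : ∑ p ∈ IT ×ˢ IS, ‖γ p.1 p.2‖ = ∑ r ∈ IT, ∑ s ∈ IS, ‖γ r s‖ :=
        Finset.sum_product' IT IS (fun r s => ‖γ r s‖)
      have e2 : ∑ p ∈ IT ×ˢ IS, ‖γ p.1 p.2‖ ^ 2 = ∑ r ∈ IT, ∑ s ∈ IS, ‖γ r s‖ ^ 2 :=
        Finset.sum_product' IT IS (fun r s => ‖γ r s‖ ^ 2)
      rw [e1, e2, Finset.card_product, Nat.cast_mul] at h1
      have h0 : 0 ≤ ∑ r ∈ IT, ∑ s ∈ IS, ‖γ r s‖ := sum_nonneg fun _ _ => sum_nonneg fun _ _ => norm_nonneg _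
      calc ∑ r ∈ IT, ∑ s ∈ IS, ‖γ r s‖ = Real.sqrt ((∑ r ∈ IT, ∑ s ∈ IS, ‖γ r s‖) ^ 2) :=
            (Real.sqrt_sq h0).symm
        _ ≤ Real.sqrt ((#IT : ℝ) * #IS * ∑ r ∈ IT, ∑ s ∈ IS, ‖γ r s‖ ^ 2) := Real.sqrt_le_sqrt h1
        _ = _ := Real.sqrt_mul (mul_nonneg (Nat.cast_nonneg _) (Nat.cast_nonneg _)) _
    have hbox : Real.sqrt ((#IT : ℝ) * #IS) * Real.sqrt ((#IT : ℝ) * #IS) ≤ 2 * (X * S) := by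
      rw [Real.mul_self_sqrt (mul_nonneg (Nat.cast_nonneg _) (Nat.cast_nonneg _)), hcardS]
      exact mul_le_mul_of_nonneg_right hcard hS0 |>.trans (le_of_eq (by ring))
    calc f 1 ≤ ∑ r₁ ∈ IT, ∑ s₁ ∈ IS, ∑ r₂ ∈ IT, ∑ s₂ ∈ IS, ‖α r₁ s₁‖ * ‖β r₂ s₂‖ := by
          simp only [hf]
          refine (norm_sum_le _ _).trans (sum_le_sum fun r₁ _ => ?_)
          refine (norm_sum_le _ _).trans (sum_le_sum fun s₁ _ => ?_)
          refine (norm_sum_le _ _).trans (sum_le_sum fun r₂ _ => ?_)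
          refine (norm_sum_le _ _).trans (sum_le_sum fun s₂ _ => ?_)
          split_ifs
          · rw [norm_mul, norm_mul, Complex.norm_conj]
            refine (mul_le_mul_of_nonneg_left (norm_jacobiSym_le_one'' _ _)
              (mul_nonneg (norm_nonneg _) (norm_nonneg _))).trans ?_
            rw [mul_one]
          · rw [norm_zero]
            exact mul_nonneg (norm_nonneg _) (norm_nonneg _)
      _ = (∑ r₁ ∈ IT, ∑ s₁ ∈ IS, ‖α r₁ s₁‖) * (∑ r₂ ∈ IT, ∑ s₂ ∈ IS, ‖β r₂ s₂‖) := by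
          simp_rw [← Finset.mul_sum, ← Finset.sum_mul]
      _ ≤ (Real.sqrt ((#IT : ℝ) * #IS) * Na) * (Real.sqrt ((#IT : ℝ) * #IS) * Nb) :=
          mul_le_mul (hCS α) (hCS β) (sum_nonneg fun _ _ => sum_nonneg fun _ _ => norm_nonneg _)
            (mul_nonneg (Real.sqrt_nonneg _) hNa0)
      _ = Real.sqrt ((#IT : ℝ) * #IS) * Real.sqrt ((#IT : ℝ) * #IS) * (Na * Nb) := by ring
      _ ≤ 2 * (X * S) * (Na * Nb) := mul_le_mul_of_nonneg_right hbox hNN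
  -- split off `q = 1` and fibre the rest by dyadic blocks
  set J : ℕ := Nat.log 2 ⌊Q₂⌋₊ + 1 with hJ
  have hJle : (J : ℝ) ≤ 2 * (1 + Real.log Q₂) := by
    rw [hJ]
    exact natLog_two_succ_le_two_mul hQ₂ (Nat.floor_le (by linarith))
  have hsplit : ∑ q ∈ 𝒬, f q = ∑ q ∈ 𝒬.filter (fun q => q = 1), f q +
      ∑ q ∈ 𝒬.filter (fun q => ¬q = 1), f q := (sum_filter_add_sum_filter_not 𝒬 _ f).symm
  have hfirst : ∑ q ∈ 𝒬.filter (fun q => q = 1), f q ≤ 2 * (X * S) * (Na * Nb) := by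
    calc ∑ q ∈ 𝒬.filter (fun q => q = 1), f q ≤ ∑ q ∈ ({1} : Finset ℕ), f q := by
          refine sum_le_sum_of_subset_of_nonneg ?_ fun q _ _ => hf0 q
          intro q hq
          rw [mem_filter] at hq
          rw [mem_singleton]
          exact hq.2
      _ = f 1 := sum_singleton _ _
      _ ≤ _ := hone
  have hsecond : ∑ q ∈ 𝒬.filter (fun q => ¬q = 1), f q ≤ J * Bmax := by
    have hmaps : ∀ q ∈ 𝒬.filter (fun q => ¬q = 1), Nat.log 2 (q - 1) ∈ range J := by
      intro q hq
      rw [mem_filter] at hq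
      obtain ⟨hq1, _, hqQ₂⟩ := h𝒬 q hq.1
      rw [mem_range, hJ, Nat.lt_succ_iff]
      refine Nat.log_mono_right ?_
      have : q ≤ ⌊Q₂⌋₊ := Nat.le_floor hqQ₂
      omega
    rw [← sum_fiberwise_of_maps_to hmaps]
    calc ∑ j ∈ range J, ∑ q ∈ (𝒬.filter (fun q => ¬q = 1)).filter (fun q => Nat.log 2 (q - 1) = j), f q
        ≤ ∑ j ∈ range J, Bmax := by
          refine sum_le_sum fun j _ => ?_
          set Fj := (𝒬.filter (fun q => ¬q = 1)).filter (fun q => Nat.log 2 (q - 1) = j) with hFj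
          -- every element of the fibre lies in the block `(2^j, 2·2^j]`
          have hFjsub : ∀ q ∈ Fj, q ∈ 𝒬 ∧ 2 ^ j < q ∧ q ≤ 2 * 2 ^ j := by
            intro q hq
            rw [hFj, mem_filter, mem_filter] at hq
            obtain ⟨⟨hq𝒬, hq1⟩, hlog⟩ := hq
            obtain ⟨hq1', _, _⟩ := h𝒬 q hq𝒬
            have hq2 : q - 1 ≠ 0 := by omega
            have h1 : 2 ^ j ≤ q - 1 := by rw [← hlog]; exact Nat.pow_log_le_self 2 hq2
            have h2 : q - 1 < 2 ^ (j + 1) := by rw [← hlog]; exact Nat.lt_pow_succ_log_self one_lt_two _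
            refine ⟨hq𝒬, by omega, ?_⟩
            rw [pow_succ] at h2
            omega
          rcases Fj.eq_empty_or_nonempty with he | ⟨q₀, hq₀⟩
          · rw [he, sum_empty]; exact hBmax0
          · obtain ⟨hq₀𝒬, hl, hu⟩ := hFjsub q₀ hq₀
            calc ∑ q ∈ Fj, f q ≤ ∑ q ∈ Ioc (2 ^ j) (2 * 2 ^ j), f q := by
                  refine sum_le_sum_of_subset_of_nonneg ?_ fun q _ _ => hf0 q
                  intro q hq
                  obtain ⟨_, hl', hu'⟩ := hFjsub q hq
                  exact mem_Ioc.mpr ⟨hl', hu'⟩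
              _ ≤ Bmax := hblock j ⟨q₀, hq₀𝒬, hl, hu⟩
      _ = J * Bmax := by rw [sum_const, card_range, nsmul_eq_mul]
  -- final arithmetic
  have hL1 : 1 ≤ 1 + Real.log Q₂ := by linarith
  have hfin1 : 2 * (X * S) * (Na * Nb) ≤ (4 * C + 2) * (1 + Real.log Q₂) * ((X * S) * (Na * Nb)) := by
    have h2 : (2 : ℝ) ≤ (4 * C + 2) * (1 + Real.log Q₂) := by
      have : (2 : ℝ) * 1 ≤ (4 * C + 2) * (1 + Real.log Q₂) :=
        mul_le_mul (by linarith) hL1 zero_le_one (by linarith)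
      linarith
    have h0 : 0 ≤ (X * S) * (Na * Nb) := mul_nonneg hXS0 hNN
    calc 2 * (X * S) * (Na * Nb) = 2 * ((X * S) * (Na * Nb)) := by ring
      _ ≤ (4 * C + 2) * (1 + Real.log Q₂) * ((X * S) * (Na * Nb)) :=
          mul_le_mul_of_nonneg_right h2 h0
  have hfin2 : (J : ℝ) * Bmax ≤ (4 * C + 2) * (1 + Real.log Q₂) *
      (X * S / Real.sqrt ((m : ℝ) * Q₁) * Real.log (2 * R) * (Na * Nb) +
        ((m : ℝ) * Q₂ * Real.sqrt (X * S) + X * (S : ℝ) ^ (3 / 4 : ℝ) + (S : ℝ) * X ^ (3 / 4 : ℝ)) *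
          (X * S) ^ ε * (Ta * Tb)) := by
    have hs2 : Real.sqrt 2 ≤ 2 := by
      rw [show (2 : ℝ) = Real.sqrt 4 by rw [show (4:ℝ) = 2 ^ 2 by norm_num, Real.sqrt_sq (by norm_num)]]
      exact Real.sqrt_le_sqrt (by norm_num)
    have hP1 : 0 ≤ X * S / Real.sqrt ((m : ℝ) * Q₁) * Real.log (2 * R) * (Na * Nb) :=
      mul_nonneg (mul_nonneg (div_nonneg hXS0 (Real.sqrt_nonneg _)) hlogR) hNN
    have hP2 : 0 ≤ ((m : ℝ) * Q₂ * Real.sqrt (X * S) + X * (S : ℝ) ^ (3 / 4 : ℝ) +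
        (S : ℝ) * X ^ (3 / 4 : ℝ)) * (X * S) ^ ε * (Ta * Tb) :=
      mul_nonneg (mul_nonneg (add_nonneg (add_nonneg (mul_nonneg (mul_nonneg hm0.le
        (by linarith)) (Real.sqrt_nonneg _)) (mul_nonneg hX0 (Real.rpow_nonneg hS0 _)))
        (mul_nonneg hS0 (Real.rpow_nonneg hX0 _))) hXSe) hTT
    have hB2 : Bmax ≤ 2 * C * (X * S / Real.sqrt ((m : ℝ) * Q₁) * Real.log (2 * R) * (Na * Nb) +
        ((m : ℝ) * Q₂ * Real.sqrt (X * S) + X * (S : ℝ) ^ (3 / 4 : ℝ) + (S : ℝ) * X ^ (3 / 4 : ℝ)) *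
          (X * S) ^ ε * (Ta * Tb)) := by
      rw [hBmax]
      have e : X * S * (Real.sqrt 2 / Real.sqrt ((m : ℝ) * Q₁)) * Real.log (2 * R) * (Na * Nb) =
          Real.sqrt 2 * (X * S / Real.sqrt ((m : ℝ) * Q₁) * Real.log (2 * R) * (Na * Nb)) := by ring
      rw [e]
      calc C * (Real.sqrt 2 * (X * S / Real.sqrt ((m : ℝ) * Q₁) * Real.log (2 * R) * (Na * Nb)) +
            ((m : ℝ) * Q₂ * Real.sqrt (X * S) + X * (S : ℝ) ^ (3 / 4 : ℝ) + (S : ℝ) * X ^ (3 / 4 : ℝ)) *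
              (X * S) ^ ε * (Ta * Tb))
          ≤ C * (2 * (X * S / Real.sqrt ((m : ℝ) * Q₁) * Real.log (2 * R) * (Na * Nb)) +
            2 * (((m : ℝ) * Q₂ * Real.sqrt (X * S) + X * (S : ℝ) ^ (3 / 4 : ℝ) +
              (S : ℝ) * X ^ (3 / 4 : ℝ)) * (X * S) ^ ε * (Ta * Tb))) :=
            mul_le_mul_of_nonneg_left (add_le_add (mul_le_mul_of_nonneg_right hs2 hP1)
              (by linarith)) hC.le
        _ = _ := by ring
    have hPP : 0 ≤ (1 + Real.log Q₂) * (X * S / Real.sqrt ((m : ℝ) * Q₁) * Real.log (2 * R) *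
        (Na * Nb) + ((m : ℝ) * Q₂ * Real.sqrt (X * S) + X * (S : ℝ) ^ (3 / 4 : ℝ) +
          (S : ℝ) * X ^ (3 / 4 : ℝ)) * (X * S) ^ ε * (Ta * Tb)) :=
      mul_nonneg (by linarith) (add_nonneg hP1 hP2)
    calc (J : ℝ) * Bmax ≤ 2 * (1 + Real.log Q₂) * Bmax := mul_le_mul_of_nonneg_right hJle hBmax0
      _ ≤ 2 * (1 + Real.log Q₂) * (2 * C * (X * S / Real.sqrt ((m : ℝ) * Q₁) * Real.log (2 * R) *
            (Na * Nb) + ((m : ℝ) * Q₂ * Real.sqrt (X * S) + X * (S : ℝ) ^ (3 / 4 : ℝ) +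
            (S : ℝ) * X ^ (3 / 4 : ℝ)) * (X * S) ^ ε * (Ta * Tb))) :=
          mul_le_mul_of_nonneg_left hB2 (by linarith)
      _ = 4 * C * ((1 + Real.log Q₂) * (X * S / Real.sqrt ((m : ℝ) * Q₁) * Real.log (2 * R) *
            (Na * Nb) + ((m : ℝ) * Q₂ * Real.sqrt (X * S) + X * (S : ℝ) ^ (3 / 4 : ℝ) +
            (S : ℝ) * X ^ (3 / 4 : ℝ)) * (X * S) ^ ε * (Ta * Tb))) := by ring
      _ ≤ (4 * C + 2) * ((1 + Real.log Q₂) * (X * S / Real.sqrt ((m : ℝ) * Q₁) * Real.log (2 * R) *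
            (Na * Nb) + ((m : ℝ) * Q₂ * Real.sqrt (X * S) + X * (S : ℝ) ^ (3 / 4 : ℝ) +
            (S : ℝ) * X ^ (3 / 4 : ℝ)) * (X * S) ^ ε * (Ta * Tb))) :=
          mul_le_mul_of_nonneg_right (by linarith) hPP
      _ = _ := by ring
  calc ∑ q ∈ 𝒬, f q = _ := hsplit
    _ ≤ 2 * (X * S) * (Na * Nb) + J * Bmax := add_le_add hfirst hsecond
    _ ≤ _ := add_le_add hfin1 hfin2
    _ = _ := by ring

/-- **Proposition 11.1* over a range of moduli, sharp `q = 1` term** [FI, §12, (12.12) and after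
(12.16)]: as `exists_prop111Star_mixed_range`, but the block-free modulus `q = 1` — which occurs only
when `Q₁ < 1` — is charged `XS/√Q₁ · ‖α‖‖β‖` instead of `XS‖α‖‖β‖` (this is the form whose sum over
`c ∣ r` stays within `(DHRS)^{1/2} τ(r)`): for every
`0 < ε ≤ 1` there is `C > 0` such that for `m, S ≥ 1`, `1 ≤ N ≤ R`, reals `Q₁ > 0`, `Q₂ ≥ 1`, a finite
set `𝒬` of moduli `q ≥ 1` with `Q₁ < q ≤ Q₂`, and vectors `α, β` on the reduced box
`R/N < r ≤ 2R/N`, `S < s ≤ 2S` supported on odd `r` coprime to `m`,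
`∑_{q ∈ 𝒬} |∑∑_{qm ∣ r₁s₂−r₂s₁, (r₁,r₂)=1} α_{r₁s₁} β̄_{r₂s₂} (q/(r₁r₂))|
   ≤ C (1 + log Q₂) { (XS/√(mQ₁) · log 2R + XS/√Q₁) ‖α‖‖β‖
       + (mQ₂√(XS) + XS^{3/4} + SX^{3/4}) (XS)^ε (∑τ(r)|α_{rs}|²)^{1/2} (∑τ(r)|β_{rs}|²)^{1/2} }`, `X = R/N`
(dyadic blocks `2^j < q ≤ 2^{j+1}` via `exists_prop111Star_mixed`; the block-free modulus `q = 1`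
trivially). [cite: FriedlanderIwaniecAnnals1998, §12, (12.12), (12.15)–(12.16)] -/
theorem exists_prop111Star_mixed_range' {ε : ℝ} (hε : 0 < ε) (hε1 : ε ≤ 1) :
    ∃ C : ℝ, 0 < C ∧ ∀ (m R S N : ℕ) (𝒬 : Finset ℕ) (Q₁ Q₂ : ℝ) (α β : ℕ → ℕ → ℂ),
      1 ≤ m → 1 ≤ S → 1 ≤ N → N ≤ R → 0 < Q₁ → 1 ≤ Q₂ →
      (∀ q ∈ 𝒬, 1 ≤ q ∧ Q₁ < (q : ℝ) ∧ (q : ℝ) ≤ Q₂) →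
      (∀ r s, α r s ≠ 0 → Odd r ∧ r.Coprime m) → (∀ r s, β r s ≠ 0 → Odd r ∧ r.Coprime m) →
      ∑ q ∈ 𝒬, ‖∑ r₁ ∈ Ioc (R / N) (2 * R / N), ∑ s₁ ∈ Ioc S (2 * S),
          ∑ r₂ ∈ Ioc (R / N) (2 * R / N), ∑ s₂ ∈ Ioc S (2 * S),
          (if ((q * m : ℕ) : ℤ) ∣ (r₁ : ℤ) * s₂ - (r₂ : ℤ) * s₁ ∧ r₁.Coprime r₂ then
            α r₁ s₁ * conj (β r₂ s₂) * (J((q : ℤ) | r₁ * r₂) : ℂ) else 0)‖ ≤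
        C * (1 + Real.log Q₂) *
          (((R : ℝ) / N * S / Real.sqrt ((m : ℝ) * Q₁) * Real.log (2 * R) +
              (R : ℝ) / N * S / Real.sqrt Q₁) *
              (Real.sqrt (∑ r ∈ Ioc (R / N) (2 * R / N), ∑ s ∈ Ioc S (2 * S), ‖α r s‖ ^ 2) *
                Real.sqrt (∑ r ∈ Ioc (R / N) (2 * R / N), ∑ s ∈ Ioc S (2 * S), ‖β r s‖ ^ 2)) +
            ((m : ℝ) * Q₂ * Real.sqrt ((R : ℝ) / N * S) + (R : ℝ) / N * (S : ℝ) ^ (3 / 4 : ℝ) +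
                (S : ℝ) * ((R : ℝ) / N) ^ (3 / 4 : ℝ)) * ((R : ℝ) / N * S) ^ ε *
              (Real.sqrt (∑ r ∈ Ioc (R / N) (2 * R / N), ∑ s ∈ Ioc S (2 * S),
                  (σ 0 r : ℝ) * ‖α r s‖ ^ 2) *
                Real.sqrt (∑ r ∈ Ioc (R / N) (2 * R / N), ∑ s ∈ Ioc S (2 * S),
                  (σ 0 r : ℝ) * ‖β r s‖ ^ 2))) := by
  obtain ⟨C, hC, h111⟩ := exists_prop111Star_mixed hε hε1
  refine ⟨4 * C + 2, by positivity, fun m R S N 𝒬 Q₁ Q₂ α β hm hS hN hNR hQ₁ hQ₂ h𝒬 hα hβ => ?_⟩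
  set IT := Ioc (R / N) (2 * R / N) with hIT
  set IS := Ioc S (2 * S) with hIS
  set X : ℝ := (R : ℝ) / N with hX
  set Na : ℝ := Real.sqrt (∑ r ∈ IT, ∑ s ∈ IS, ‖α r s‖ ^ 2) with hNa
  set Nb : ℝ := Real.sqrt (∑ r ∈ IT, ∑ s ∈ IS, ‖β r s‖ ^ 2) with hNb
  set Ta : ℝ := Real.sqrt (∑ r ∈ IT, ∑ s ∈ IS, (σ 0 r : ℝ) * ‖α r s‖ ^ 2) with hTa
  set Tb : ℝ := Real.sqrt (∑ r ∈ IT, ∑ s ∈ IS, (σ 0 r : ℝ) * ‖β r s‖ ^ 2) with hTb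
  set f : ℕ → ℝ := fun q => ‖∑ r₁ ∈ IT, ∑ s₁ ∈ IS, ∑ r₂ ∈ IT, ∑ s₂ ∈ IS,
      (if ((q * m : ℕ) : ℤ) ∣ (r₁ : ℤ) * s₂ - (r₂ : ℤ) * s₁ ∧ r₁.Coprime r₂ then
        α r₁ s₁ * conj (β r₂ s₂) * (J((q : ℤ) | r₁ * r₂) : ℂ) else 0)‖ with hf
  have hf0 : ∀ q, 0 ≤ f q := fun q => norm_nonneg _
  -- basic positivity
  have hR1 : (1 : ℝ) ≤ R := by exact_mod_cast hN.trans hNR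
  have hX1 : 1 ≤ X := by
    rw [hX, le_div_iff₀ (by exact_mod_cast hN)]; simpa using (show (N : ℝ) ≤ R by exact_mod_cast hNR)
  have hX0 : 0 ≤ X := zero_le_one.trans hX1
  have hS0 : (0 : ℝ) ≤ S := Nat.cast_nonneg S
  have hm0 : (0 : ℝ) < m := by exact_mod_cast hm
  have hlogR : 0 ≤ Real.log (2 * R) := Real.log_nonneg (by linarith)
  have hlogQ : 0 ≤ Real.log Q₂ := Real.log_nonneg hQ₂
  have hNa0 : 0 ≤ Na := Real.sqrt_nonneg _
  have hNb0 : 0 ≤ Nb := Real.sqrt_nonneg _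
  have hTa0 : 0 ≤ Ta := Real.sqrt_nonneg _
  have hTb0 : 0 ≤ Tb := Real.sqrt_nonneg _
  have hXS0 : 0 ≤ X * S := mul_nonneg hX0 hS0
  have hXSe : 0 ≤ (X * S) ^ ε := Real.rpow_nonneg hXS0 ε
  have hNN : 0 ≤ Na * Nb := mul_nonneg hNa0 hNb0
  have hTT : 0 ≤ Ta * Tb := mul_nonneg hTa0 hTb0
  have hP3 : 0 ≤ X * (S : ℝ) ^ (3 / 4 : ℝ) + (S : ℝ) * X ^ (3 / 4 : ℝ) :=
    add_nonneg (mul_nonneg hX0 (Real.rpow_nonneg hS0 _)) (mul_nonneg hS0 (Real.rpow_nonneg hX0 _))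
  -- the uniform bound for one block meeting the range
  set Bmax : ℝ := C * (X * S * (Real.sqrt 2 / Real.sqrt ((m : ℝ) * Q₁)) * Real.log (2 * R) *
      (Na * Nb) + ((m : ℝ) * Q₂ * Real.sqrt (X * S) + X * (S : ℝ) ^ (3 / 4 : ℝ) +
        (S : ℝ) * X ^ (3 / 4 : ℝ)) * (X * S) ^ ε * (Ta * Tb)) with hBmax
  have hBmax0 : 0 ≤ Bmax := by
    rw [hBmax]
    refine mul_nonneg hC.le (add_nonneg ?_ ?_)
    · exact mul_nonneg (mul_nonneg (mul_nonneg hXS0 (div_nonneg (Real.sqrt_nonneg _)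
        (Real.sqrt_nonneg _))) hlogR) hNN
    · exact mul_nonneg (mul_nonneg (add_nonneg (add_nonneg (mul_nonneg (mul_nonneg hm0.le
        (by linarith)) (Real.sqrt_nonneg _)) (mul_nonneg hX0 (Real.rpow_nonneg hS0 _)))
        (mul_nonneg hS0 (Real.rpow_nonneg hX0 _))) hXSe) hTT
  have hblock : ∀ j : ℕ, (∃ q ∈ 𝒬, 2 ^ j < q ∧ q ≤ 2 * 2 ^ j) →
      ∑ q ∈ Ioc (2 ^ j) (2 * 2 ^ j), f q ≤ Bmax := by
    intro j ⟨q₀, hq₀, hq₀l, hq₀u⟩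
    obtain ⟨_, hQ₁q, hqQ₂⟩ := h𝒬 q₀ hq₀
    have hD : 1 ≤ 2 ^ j := Nat.one_le_two_pow
    have h : ∑ q ∈ Ioc (2 ^ j) (2 * 2 ^ j), f q ≤
        C * (X * S / Real.sqrt ((m : ℝ) * (2 ^ j : ℕ)) * Real.log (2 * R) * (Na * Nb) +
          ((m : ℝ) * (2 ^ j : ℕ) * Real.sqrt (X * S) + X * (S : ℝ) ^ (3 / 4 : ℝ) +
            (S : ℝ) * X ^ (3 / 4 : ℝ)) * (X * S) ^ ε * (Ta * Tb)) :=
      h111 m (2 ^ j) R S N α β hm hD hS hN hNR hα hβ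
    have hDr : (0 : ℝ) < (2 : ℝ) ^ j := by positivity
    have hDQ₁ : Q₁ / 2 ≤ (2 : ℝ) ^ j := by
      have : (q₀ : ℝ) ≤ 2 * (2 : ℝ) ^ j := by exact_mod_cast hq₀u
      linarith
    have hDQ₂ : (2 : ℝ) ^ j ≤ Q₂ := by
      have : ((2 ^ j : ℕ) : ℝ) < q₀ := by exact_mod_cast hq₀l
      push_cast at this
      linarith
    -- compare the two `D`-dependent factors
    have hinv : 1 / Real.sqrt ((m : ℝ) * (2 ^ j : ℕ)) ≤ Real.sqrt 2 / Real.sqrt ((m : ℝ) * Q₁) := by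
      push_cast
      rw [div_le_div_iff₀ (by positivity) (by positivity), one_mul, ← Real.sqrt_mul (by norm_num)]
      refine Real.sqrt_le_sqrt ?_
      nlinarith
    have hlin : (m : ℝ) * (2 ^ j : ℕ) * Real.sqrt (X * S) ≤ (m : ℝ) * Q₂ * Real.sqrt (X * S) := by
      push_cast
      gcongr
    refine h.trans ?_
    rw [hBmax]
    have e1 : X * S / Real.sqrt ((m : ℝ) * (2 ^ j : ℕ)) =
        X * S * (1 / Real.sqrt ((m : ℝ) * (2 ^ j : ℕ))) := by ring
    rw [e1]
    refine mul_le_mul_of_nonneg_left (add_le_add ?_ ?_) hC.le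
    · exact mul_le_mul_of_nonneg_right (mul_le_mul_of_nonneg_right
        (mul_le_mul_of_nonneg_left hinv hXS0) hlogR) hNN
    · refine mul_le_mul_of_nonneg_right (mul_le_mul_of_nonneg_right ?_ hXSe) hTT
      linarith [hlin]
  -- the modulus `q = 1`
  have hone : f 1 ≤ 2 * (X * S) * (Na * Nb) := by
    have hcard : (#IT : ℝ) ≤ 2 * X := by
      rw [hIT, Nat.card_Ioc]
      have h1 : ((2 * R / N - R / N : ℕ) : ℝ) ≤ ((2 * R / N : ℕ) : ℝ) := by
        exact_mod_cast Nat.sub_le _ _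
      refine h1.trans ?_
      calc ((2 * R / N : ℕ) : ℝ) ≤ (2 * R : ℕ) / (N : ℝ) := Nat.cast_div_le
        _ = 2 * X := by rw [hX]; push_cast; ring
    have hcardS : (#IS : ℝ) = S := by
      rw [hIS, Nat.card_Ioc, show 2 * S - S = S by omega]
    -- `∑∑ |γ| ≤ √(#box) ‖γ‖`
    have hCS : ∀ γ : ℕ → ℕ → ℂ, ∑ r ∈ IT, ∑ s ∈ IS, ‖γ r s‖ ≤
        Real.sqrt ((#IT : ℝ) * #IS) * Real.sqrt (∑ r ∈ IT, ∑ s ∈ IS, ‖γ r s‖ ^ 2) := by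
      intro γ
      have h1 : (∑ p ∈ IT ×ˢ IS, ‖γ p.1 p.2‖) ^ 2 ≤ #(IT ×ˢ IS) * ∑ p ∈ IT ×ˢ IS, ‖γ p.1 p.2‖ ^ 2 :=
        sq_sum_le_card_mul_sum_sq
      have e1 : ∑ p ∈ IT ×ˢ IS, ‖γ p.1 p.2‖ = ∑ r ∈ IT, ∑ s ∈ IS, ‖γ r s‖ :=
        Finset.sum_product' IT IS (fun r s => ‖γ r s‖)
      have e2 : ∑ p ∈ IT ×ˢ IS, ‖γ p.1 p.2‖ ^ 2 = ∑ r ∈ IT, ∑ s ∈ IS, ‖γ r s‖ ^ 2 :=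
        Finset.sum_product' IT IS (fun r s => ‖γ r s‖ ^ 2)
      rw [e1, e2, Finset.card_product, Nat.cast_mul] at h1
      have h0 : 0 ≤ ∑ r ∈ IT, ∑ s ∈ IS, ‖γ r s‖ := sum_nonneg fun _ _ => sum_nonneg fun _ _ => norm_nonneg _
      calc ∑ r ∈ IT, ∑ s ∈ IS, ‖γ r s‖ = Real.sqrt ((∑ r ∈ IT, ∑ s ∈ IS, ‖γ r s‖) ^ 2) :=
            (Real.sqrt_sq h0).symm
        _ ≤ Real.sqrt ((#IT : ℝ) * #IS * ∑ r ∈ IT, ∑ s ∈ IS, ‖γ r s‖ ^ 2) := Real.sqrt_le_sqrt h1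
        _ = _ := Real.sqrt_mul (mul_nonneg (Nat.cast_nonneg _) (Nat.cast_nonneg _)) _
    have hbox : Real.sqrt ((#IT : ℝ) * #IS) * Real.sqrt ((#IT : ℝ) * #IS) ≤ 2 * (X * S) := by
      rw [Real.mul_self_sqrt (mul_nonneg (Nat.cast_nonneg _) (Nat.cast_nonneg _)), hcardS]
      exact mul_le_mul_of_nonneg_right hcard hS0 |>.trans (le_of_eq (by ring))
    calc f 1 ≤ ∑ r₁ ∈ IT, ∑ s₁ ∈ IS, ∑ r₂ ∈ IT, ∑ s₂ ∈ IS, ‖α r₁ s₁‖ * ‖β r₂ s₂‖ := by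
          simp only [hf]
          refine (norm_sum_le _ _).trans (sum_le_sum fun r₁ _ => ?_)
          refine (norm_sum_le _ _).trans (sum_le_sum fun s₁ _ => ?_)
          refine (norm_sum_le _ _).trans (sum_le_sum fun r₂ _ => ?_)
          refine (norm_sum_le _ _).trans (sum_le_sum fun s₂ _ => ?_)
          split_ifs
          · rw [norm_mul, norm_mul, Complex.norm_conj]
            refine (mul_le_mul_of_nonneg_left (norm_jacobiSym_le_one'' _ _)
              (mul_nonneg (norm_nonneg _) (norm_nonneg _))).trans ?_
            rw [mul_one]
          · rw [norm_zero]
            exact mul_nonneg (norm_nonneg _) (norm_nonneg _)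
      _ = (∑ r₁ ∈ IT, ∑ s₁ ∈ IS, ‖α r₁ s₁‖) * (∑ r₂ ∈ IT, ∑ s₂ ∈ IS, ‖β r₂ s₂‖) := by
          simp_rw [← Finset.mul_sum, ← Finset.sum_mul]
      _ ≤ (Real.sqrt ((#IT : ℝ) * #IS) * Na) * (Real.sqrt ((#IT : ℝ) * #IS) * Nb) :=
          mul_le_mul (hCS α) (hCS β) (sum_nonneg fun _ _ => sum_nonneg fun _ _ => norm_nonneg _)
            (mul_nonneg (Real.sqrt_nonneg _) hNa0)
      _ = Real.sqrt ((#IT : ℝ) * #IS) * Real.sqrt ((#IT : ℝ) * #IS) * (Na * Nb) := by ring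
      _ ≤ 2 * (X * S) * (Na * Nb) := mul_le_mul_of_nonneg_right hbox hNN
  -- split off `q = 1` and fibre the rest by dyadic blocks
  set J : ℕ := Nat.log 2 ⌊Q₂⌋₊ + 1 with hJ
  have hJle : (J : ℝ) ≤ 2 * (1 + Real.log Q₂) := by
    rw [hJ]
    exact natLog_two_succ_le_two_mul hQ₂ (Nat.floor_le (by linarith))
  have hsplit : ∑ q ∈ 𝒬, f q = ∑ q ∈ 𝒬.filter (fun q => q = 1), f q +
      ∑ q ∈ 𝒬.filter (fun q => ¬q = 1), f q := (sum_filter_add_sum_filter_not 𝒬 _ f).symm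
  have hsQ₁ : 0 < Real.sqrt Q₁ := Real.sqrt_pos.mpr hQ₁
  have hfirst : ∑ q ∈ 𝒬.filter (fun q => q = 1), f q ≤ 2 * (X * S / Real.sqrt Q₁) * (Na * Nb) := by
    by_cases h1 : (1 : ℕ) ∈ 𝒬
    · obtain ⟨_, hQ₁1, _⟩ := h𝒬 1 h1
      have hs1 : Real.sqrt Q₁ ≤ 1 := by
        rw [show (1 : ℝ) = Real.sqrt 1 by simp]
        exact Real.sqrt_le_sqrt (by exact_mod_cast hQ₁1.le)
      have hXS1 : X * S ≤ X * S / Real.sqrt Q₁ := by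
        rw [le_div_iff₀ hsQ₁]
        calc X * S * Real.sqrt Q₁ ≤ X * S * 1 := mul_le_mul_of_nonneg_left hs1 hXS0
          _ = X * S := mul_one _
      calc ∑ q ∈ 𝒬.filter (fun q => q = 1), f q ≤ ∑ q ∈ ({1} : Finset ℕ), f q := by
            refine sum_le_sum_of_subset_of_nonneg ?_ fun q _ _ => hf0 q
            intro q hq
            rw [mem_filter] at hq
            rw [mem_singleton]
            exact hq.2
        _ = f 1 := sum_singleton _ _
        _ ≤ 2 * (X * S) * (Na * Nb) := hone
        _ ≤ 2 * (X * S / Real.sqrt Q₁) * (Na * Nb) :=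
            mul_le_mul_of_nonneg_right (mul_le_mul_of_nonneg_left hXS1 (by norm_num)) hNN
    · have he : 𝒬.filter (fun q => q = 1) = ∅ := by
        rw [Finset.filter_eq_empty_iff]
        intro q hq hq1
        exact h1 (hq1 ▸ hq)
      rw [he, sum_empty]
      exact mul_nonneg (mul_nonneg (by norm_num) (div_nonneg hXS0 hsQ₁.le)) hNN
  have hsecond : ∑ q ∈ 𝒬.filter (fun q => ¬q = 1), f q ≤ J * Bmax := by
    have hmaps : ∀ q ∈ 𝒬.filter (fun q => ¬q = 1), Nat.log 2 (q - 1) ∈ range J := by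
      intro q hq
      rw [mem_filter] at hq
      obtain ⟨hq1, _, hqQ₂⟩ := h𝒬 q hq.1
      rw [mem_range, hJ, Nat.lt_succ_iff]
      refine Nat.log_mono_right ?_
      have : q ≤ ⌊Q₂⌋₊ := Nat.le_floor hqQ₂
      omega
    rw [← sum_fiberwise_of_maps_to hmaps]
    calc ∑ j ∈ range J, ∑ q ∈ (𝒬.filter (fun q => ¬q = 1)).filter (fun q => Nat.log 2 (q - 1) = j), f q
        ≤ ∑ j ∈ range J, Bmax := by
          refine sum_le_sum fun j _ => ?_
          set Fj := (𝒬.filter (fun q => ¬q = 1)).filter (fun q => Nat.log 2 (q - 1) = j) with hFj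
          -- every element of the fibre lies in the block `(2^j, 2·2^j]`
          have hFjsub : ∀ q ∈ Fj, q ∈ 𝒬 ∧ 2 ^ j < q ∧ q ≤ 2 * 2 ^ j := by
            intro q hq
            rw [hFj, mem_filter, mem_filter] at hq
            obtain ⟨⟨hq𝒬, hq1⟩, hlog⟩ := hq
            obtain ⟨hq1', _, _⟩ := h𝒬 q hq𝒬
            have hq2 : q - 1 ≠ 0 := by omega
            have h1 : 2 ^ j ≤ q - 1 := by rw [← hlog]; exact Nat.pow_log_le_self 2 hq2
            have h2 : q - 1 < 2 ^ (j + 1) := by rw [← hlog]; exact Nat.lt_pow_succ_log_self one_lt_two _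
            refine ⟨hq𝒬, by omega, ?_⟩
            rw [pow_succ] at h2
            omega
          rcases Fj.eq_empty_or_nonempty with he | ⟨q₀, hq₀⟩
          · rw [he, sum_empty]; exact hBmax0
          · obtain ⟨hq₀𝒬, hl, hu⟩ := hFjsub q₀ hq₀
            calc ∑ q ∈ Fj, f q ≤ ∑ q ∈ Ioc (2 ^ j) (2 * 2 ^ j), f q := by
                  refine sum_le_sum_of_subset_of_nonneg ?_ fun q _ _ => hf0 q
                  intro q hq
                  obtain ⟨_, hl', hu'⟩ := hFjsub q hq
                  exact mem_Ioc.mpr ⟨hl', hu'⟩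
              _ ≤ Bmax := hblock j ⟨q₀, hq₀𝒬, hl, hu⟩
      _ = J * Bmax := by rw [sum_const, card_range, nsmul_eq_mul]
  -- final arithmetic
  have hL1 : 1 ≤ 1 + Real.log Q₂ := by linarith
  have hfin1 : 2 * (X * S / Real.sqrt Q₁) * (Na * Nb) ≤
      (4 * C + 2) * (1 + Real.log Q₂) * ((X * S / Real.sqrt Q₁) * (Na * Nb)) := by
    have h2 : (2 : ℝ) ≤ (4 * C + 2) * (1 + Real.log Q₂) := by
      have : (2 : ℝ) * 1 ≤ (4 * C + 2) * (1 + Real.log Q₂) :=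
        mul_le_mul (by linarith) hL1 zero_le_one (by linarith)
      linarith
    have h0 : 0 ≤ (X * S / Real.sqrt Q₁) * (Na * Nb) := mul_nonneg (div_nonneg hXS0 hsQ₁.le) hNN
    calc 2 * (X * S / Real.sqrt Q₁) * (Na * Nb) = 2 * ((X * S / Real.sqrt Q₁) * (Na * Nb)) := by ring
      _ ≤ (4 * C + 2) * (1 + Real.log Q₂) * ((X * S / Real.sqrt Q₁) * (Na * Nb)) :=
          mul_le_mul_of_nonneg_right h2 h0
  have hfin2 : (J : ℝ) * Bmax ≤ (4 * C + 2) * (1 + Real.log Q₂) *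
      (X * S / Real.sqrt ((m : ℝ) * Q₁) * Real.log (2 * R) * (Na * Nb) +
        ((m : ℝ) * Q₂ * Real.sqrt (X * S) + X * (S : ℝ) ^ (3 / 4 : ℝ) + (S : ℝ) * X ^ (3 / 4 : ℝ)) *
          (X * S) ^ ε * (Ta * Tb)) := by
    have hs2 : Real.sqrt 2 ≤ 2 := by
      rw [show (2 : ℝ) = Real.sqrt 4 by rw [show (4:ℝ) = 2 ^ 2 by norm_num, Real.sqrt_sq (by norm_num)]]
      exact Real.sqrt_le_sqrt (by norm_num)
    have hP1 : 0 ≤ X * S / Real.sqrt ((m : ℝ) * Q₁) * Real.log (2 * R) * (Na * Nb) :=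
      mul_nonneg (mul_nonneg (div_nonneg hXS0 (Real.sqrt_nonneg _)) hlogR) hNN
    have hP2 : 0 ≤ ((m : ℝ) * Q₂ * Real.sqrt (X * S) + X * (S : ℝ) ^ (3 / 4 : ℝ) +
        (S : ℝ) * X ^ (3 / 4 : ℝ)) * (X * S) ^ ε * (Ta * Tb) :=
      mul_nonneg (mul_nonneg (add_nonneg (add_nonneg (mul_nonneg (mul_nonneg hm0.le
        (by linarith)) (Real.sqrt_nonneg _)) (mul_nonneg hX0 (Real.rpow_nonneg hS0 _)))
        (mul_nonneg hS0 (Real.rpow_nonneg hX0 _))) hXSe) hTT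
    have hB2 : Bmax ≤ 2 * C * (X * S / Real.sqrt ((m : ℝ) * Q₁) * Real.log (2 * R) * (Na * Nb) +
        ((m : ℝ) * Q₂ * Real.sqrt (X * S) + X * (S : ℝ) ^ (3 / 4 : ℝ) + (S : ℝ) * X ^ (3 / 4 : ℝ)) *
          (X * S) ^ ε * (Ta * Tb)) := by
      rw [hBmax]
      have e : X * S * (Real.sqrt 2 / Real.sqrt ((m : ℝ) * Q₁)) * Real.log (2 * R) * (Na * Nb) =
          Real.sqrt 2 * (X * S / Real.sqrt ((m : ℝ) * Q₁) * Real.log (2 * R) * (Na * Nb)) := by ring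
      rw [e]
      calc C * (Real.sqrt 2 * (X * S / Real.sqrt ((m : ℝ) * Q₁) * Real.log (2 * R) * (Na * Nb)) +
            ((m : ℝ) * Q₂ * Real.sqrt (X * S) + X * (S : ℝ) ^ (3 / 4 : ℝ) + (S : ℝ) * X ^ (3 / 4 : ℝ)) *
              (X * S) ^ ε * (Ta * Tb))
          ≤ C * (2 * (X * S / Real.sqrt ((m : ℝ) * Q₁) * Real.log (2 * R) * (Na * Nb)) +
            2 * (((m : ℝ) * Q₂ * Real.sqrt (X * S) + X * (S : ℝ) ^ (3 / 4 : ℝ) +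
              (S : ℝ) * X ^ (3 / 4 : ℝ)) * (X * S) ^ ε * (Ta * Tb))) :=
            mul_le_mul_of_nonneg_left (add_le_add (mul_le_mul_of_nonneg_right hs2 hP1)
              (by linarith)) hC.le
        _ = _ := by ring
    have hPP : 0 ≤ (1 + Real.log Q₂) * (X * S / Real.sqrt ((m : ℝ) * Q₁) * Real.log (2 * R) *
        (Na * Nb) + ((m : ℝ) * Q₂ * Real.sqrt (X * S) + X * (S : ℝ) ^ (3 / 4 : ℝ) +
          (S : ℝ) * X ^ (3 / 4 : ℝ)) * (X * S) ^ ε * (Ta * Tb)) :=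
      mul_nonneg (by linarith) (add_nonneg hP1 hP2)
    calc (J : ℝ) * Bmax ≤ 2 * (1 + Real.log Q₂) * Bmax := mul_le_mul_of_nonneg_right hJle hBmax0
      _ ≤ 2 * (1 + Real.log Q₂) * (2 * C * (X * S / Real.sqrt ((m : ℝ) * Q₁) * Real.log (2 * R) *
            (Na * Nb) + ((m : ℝ) * Q₂ * Real.sqrt (X * S) + X * (S : ℝ) ^ (3 / 4 : ℝ) +
            (S : ℝ) * X ^ (3 / 4 : ℝ)) * (X * S) ^ ε * (Ta * Tb))) :=
          mul_le_mul_of_nonneg_left hB2 (by linarith)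
      _ = 4 * C * ((1 + Real.log Q₂) * (X * S / Real.sqrt ((m : ℝ) * Q₁) * Real.log (2 * R) *
            (Na * Nb) + ((m : ℝ) * Q₂ * Real.sqrt (X * S) + X * (S : ℝ) ^ (3 / 4 : ℝ) +
            (S : ℝ) * X ^ (3 / 4 : ℝ)) * (X * S) ^ ε * (Ta * Tb))) := by ring
      _ ≤ (4 * C + 2) * ((1 + Real.log Q₂) * (X * S / Real.sqrt ((m : ℝ) * Q₁) * Real.log (2 * R) *
            (Na * Nb) + ((m : ℝ) * Q₂ * Real.sqrt (X * S) + X * (S : ℝ) ^ (3 / 4 : ℝ) +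
            (S : ℝ) * X ^ (3 / 4 : ℝ)) * (X * S) ^ ε * (Ta * Tb))) :=
          mul_le_mul_of_nonneg_right (by linarith) hPP
      _ = _ := by ring
  calc ∑ q ∈ 𝒬, f q = _ := hsplit
    _ ≤ 2 * (X * S / Real.sqrt Q₁) * (Na * Nb) + J * Bmax := add_le_add hfirst hsecond
    _ ≤ _ := add_le_add hfin1 hfin2
    _ = _ := by ring

end Literature.NumberTheory.Sieve.FriedlanderIwaniecPrimes
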